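import Summits.ResolutionOfSingularities.ResolutionOfSingularities.Theorems.RisoStrataRisoCurvesLoc
import Summits.ResolutionOfSingularities.ResolutionOfSingularities.Theorems.RisoStrataRisoCentresResolvePlumbing
import Literature.AlgebraicGeometry.Resolution.QuadraticSequenceDimOneExistence
import Literature.AlgebraicGeometry.Resolution.NormalizationOfVarietiesProofs

/-!
# Route RisoStrata — crux `RisoCentresResolve` (stmt-ResolutionOfSingularities-18546), line `Sketch`, cycle 2:
# stub `stub_rcrHeightOneReach` (valuations with one-dimensional centre)

Let `k ⊆ K` be fields, `B ⊆ K` a finitely generated `k`-subalgebra (of ANY Krull dimension) with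
`Frac B = K`, and `O ⊊ K` a valuation ring of `K` containing `B` whose centre `p = 𝔪_O ∩ B` has a
local ring `L = B_p` of Krull dimension `≤ 1`. We prove (`stub_rcrHeightOneReach`): `O` is a
discrete valuation ring, and EVERY sequence `A 0 = L → A 1 → A 2 → ⋯` of quadratic transforms
along `O` (Herrmann–Ikeda–Orbanz, Ch. VI, (30.2)) reaches `O`: `A c = O` for some `c`.

Proof (assembling results PROVED in the tree; it generalises `stub_rcrCurveReach`, where `B`
itself was one-dimensional):
* `L = B_p ⊆ O` is a Noetherian local domain with `Frac L = K`, of dimension `≤ 1` (hypothesis)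
  and not a field (the centre of `O ≠ K` on a subring with fraction field `K` is nonzero);
* by Krull–Akizuki (`KrullAkizuki_holds.isDedekindDomain_integralClosure`, applied to `L`, not to
  `B`) the normalization `N' = integralClosure L K` is a Dedekind domain, and `N' ⊆ O` since `O` is
  integrally closed; so `V = N'_{𝔪_O ∩ N'}` is the localization of a Dedekind domain at a nonzero
  prime, a discrete valuation ring inside `O`, whence `O = V` (`toSubring_eq_of_dvr_subring`) and
  `O` is a DVR;
* the normalization `N = integralClosure B K ⊆ O` of `B` is a finite `B`-module (E. Noether,
  `NoetherFiniteIntegralClosure_holds`); with `S` a finite generating set, `N ⊆ (A 0)[S]`;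
* clearing denominators (`IsIntegral.exists_multiple_integral_of_isLocalization` for the
  localization `L` of `B` at `p`): every `z ∈ N'` has `s z ∈ N` for some `s ∈ B ∖ p`, so
  `N' ⊆ N_{𝔪_O ∩ N}` and `O = V = N'_{𝔪_O ∩ N'} ⊆ N_{𝔪_O ∩ N}`;
* these are exactly the hypotheses of Herrmann–Ikeda–Orbanz (30.2)
  (`exists_sequence_eq_valuationSubring`) for the one-dimensional Noetherian local domain
  `A 0 = L` dominated by `O`.
-/

noncomputable section

set_option linter.dupNamespace false -- mandated namespace of this single-conjunct summit

namespace Summit.ResolutionOfSingularities.ResolutionOfSingularities.Theorems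

open Literature.AlgebraicGeometry.Resolution IsLocalRing
open Literature.RingTheory.DiscreteValuationRing

section Helpers

variable {K : Type} [Field K]

/-- If `R ⊆ O ⊊ K` and every element of `K` is a fraction of elements of `R`, then some nonzero
`b ∈ R` is not a unit of `O`. [folklore] -/
private theorem h1r_exists_ne_zero_inv_not_mem (R : Subring K)
    (hfrac : ∀ z : K, ∃ a ∈ R, ∃ b ∈ R, b ≠ 0 ∧ z = a / b)
    (O : ValuationSubring K) (hRO : R ≤ O.toSubring) (hO : O ≠ ⊤) :
    ∃ b ∈ R, b ≠ 0 ∧ b⁻¹ ∉ O := by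
  by_contra h
  push Not at h
  apply hO
  rw [eq_top_iff]
  intro z _
  obtain ⟨a, ha, b, hb, hb0, rfl⟩ := hfrac z
  rw [div_eq_mul_inv]
  exact O.mul_mem _ _ (hRO ha) (h b hb hb0)

/-- Under the same hypotheses the centre `𝔪_O ∩ R` of `O` on `R` is nonzero. [folklore] -/
private theorem h1r_subringCentre_ne_bot (R : Subring K)
    (hfrac : ∀ z : K, ∃ a ∈ R, ∃ b ∈ R, b ≠ 0 ∧ z = a / b)
    (O : ValuationSubring K) (hRO : R ≤ O.toSubring) (hO : O ≠ ⊤) :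
    subringCentre R O hRO ≠ ⊥ := by
  obtain ⟨b, hb, hb0, hbi⟩ := h1r_exists_ne_zero_inv_not_mem R hfrac O hRO hO
  intro hbot
  by_cases hmem : (⟨b, hb⟩ : R) ∈ subringCentre R O hRO
  · rw [hbot, Ideal.mem_bot] at hmem
    exact hb0 (congrArg Subtype.val hmem)
  · have hv : O.valuation b = 1 := valuation_eq_one_of_not_mem_subringCentre hRO hmem
    exact hbi ((O.valuation_le_one_iff _).mp (by rw [map_inv₀, hv, inv_one]))

/-- A subring `R ⊆ O ⊊ K` with `Frac R = K` is not a field. [folklore] -/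
private theorem h1r_not_isField (R : Subring K)
    (hfrac : ∀ z : K, ∃ a ∈ R, ∃ b ∈ R, b ≠ 0 ∧ z = a / b)
    (O : ValuationSubring K) (hRO : R ≤ O.toSubring) (hO : O ≠ ⊤) : ¬ IsField ↥R := by
  obtain ⟨b, hb, hb0, hbi⟩ := h1r_exists_ne_zero_inv_not_mem R hfrac O hRO hO
  intro hF
  obtain ⟨c, hc⟩ := hF.mul_inv_cancel (a := ⟨b, hb⟩) (fun h => hb0 (congrArg Subtype.val h))
  apply hbi
  have hbc : b * (c : K) = 1 := congrArg Subtype.val hc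
  rw [inv_eq_of_mul_eq_one_right hbc]
  exact hRO c.2

/-- The integral closure in `K` of a ring `R` mapping into a valuation ring `O` of `K` lies in `O`
(`O` is integrally closed in `K`). [folklore] -/
private theorem h1r_integralClosure_le {R : Type} [CommRing R] [Algebra R K]
    (O : ValuationSubring K) (hRO : ∀ r : R, algebraMap R K r ∈ O) :
    (integralClosure R K).toSubring ≤ O.toSubring := by
  intro x hx
  have hx' : IsIntegral R x := hx
  let φ : R →+* ↥O :=
    { toFun := fun r => ⟨algebraMap R K r, hRO r⟩
      map_one' := Subtype.ext (map_one _)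
      map_mul' := fun _ _ => Subtype.ext (map_mul _ _ _)
      map_zero' := Subtype.ext (map_zero _)
      map_add' := fun _ _ => Subtype.ext (map_add _ _ _) }
  have hxO : IsIntegral ↥O x :=
    hx'.map_of_comp_eq φ (RingHom.id K) (RingHom.ext fun _ => rfl)
  obtain ⟨y, hy⟩ := IsIntegrallyClosed.algebraMap_eq_of_integral hxO
  have : x = (y : K) := hy.symm
  rw [this]
  exact y.2

end Helpers

/-- **Stub (height-one termination).** For a finitely generated `k`-subalgebra `B ⊆ O` of `K` with
`Frac B = K`, a valuation ring `O ≠ K` whose centre on `B` has a local ring of Krull dimension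
`≤ 1`, every sequence of quadratic transforms along `O` starting at `B_{𝔪_O ∩ B}` reaches `O`, a
discrete valuation ring (generalises `stub_rcrCurveReach`: `B` may have any dimension; the valuation
rings dominating the one-dimensional `B_{𝔪_O ∩ B}` are the localizations of its normalization —
E. Noether finiteness, Krull–Akizuki, Herrmann–Ikeda–Orbanz (30.2)). -/
theorem stub_rcrHeightOneReach {k K : Type} [Field k] [Field K] [Algebra k K]
    (B : Subalgebra k K) (hB : B.FG) (hfrac : ∀ z : K, ∃ a ∈ B, ∃ b ∈ B, b ≠ 0 ∧ z = a / b)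
    (O : ValuationSubring K) (hBO : B.toSubring ≤ O.toSubring) (hO : O ≠ ⊤)
    (hdim : ringKrullDim ↥(locAtCentre B.toSubring O) ≤ 1)
    (A : ℕ → Subring K) (hA0 : A 0 = locAtCentre B.toSubring O)
    (hstep : ∀ i, IsQuadraticTransformAlong O (A i) (A (i + 1))) :
    IsDiscreteValuationRing ↥O ∧ ∃ c, A c = O.toSubring := by
  classical
  -- (1) `B` is a Noetherian domain of finite type over `k` with `Frac B = K`
  haveI hBnoeth : IsNoetherianRing ↥B := isNoetherianRing_of_fg hB
  haveI : Algebra.FiniteType k ↥B := (Subalgebra.fg_iff_finiteType B).mp hB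
  haveI : FaithfulSMul ↥B K :=
    (faithfulSMul_iff_algebraMap_injective ↥B K).mpr Subtype.val_injective
  haveI : IsFractionRing ↥B K := IsFractionRing.of_field ↥B K fun z => by
    obtain ⟨a, ha, b, hb, -, rfl⟩ := hfrac z
    exact ⟨⟨a, ha⟩, ⟨b, hb⟩, rfl⟩
  -- (2) `L = B_{𝔪_O ∩ B}`: a Noetherian local domain of dimension `≤ 1`, not a field, `Frac L = K`
  set L : Subring K := locAtCentre B.toSubring O with hL
  have hBL : B.toSubring ≤ L := le_locAtCentre _ O
  have hLO : L ≤ O.toSubring := locAtCentre_le hBO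
  have hfracL : ∀ z : K, ∃ a ∈ L, ∃ b ∈ L, b ≠ 0 ∧ z = a / b := fun z => by
    obtain ⟨a, ha, b, hb, hb0, rfl⟩ := hfrac z
    exact ⟨a, hBL ha, b, hBL hb, hb0, rfl⟩
  haveI hLloc : IsLocalization.AtPrime ↥L (subringCentre B.toSubring O hBO) :=
    isLocalization_locAtCentre hBO
  haveI hLnoeth : IsNoetherianRing ↥L :=
    IsLocalization.isNoetherianRing (subringCentre B.toSubring O hBO).primeCompl _
      (show IsNoetherianRing ↥B.toSubring from hBnoeth)
  haveI hLdim : Ring.KrullDimLE 1 ↥L := Ring.krullDimLE_iff.mpr hdim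
  haveI : Ring.DimensionLEOne ↥L := dimensionLEOne_subring
  haveI : IsFractionRing ↥L K :=
    isFractionRing_of_isLocalRingOf_le (A := B.toSubring) (B := L) hfrac hBL
  have hLnf : ¬ IsField ↥L := h1r_not_isField L hfracL O hLO hO
  -- (3) the normalization `N'` of `L` is Dedekind (Krull–Akizuki) and lies in `O`
  haveI hDed : IsDedekindDomain ↥(integralClosure ↥L K) :=
    KrullAkizuki_holds.isDedekindDomain_integralClosure hLnf K K
  set N'K : Subring K := (integralClosure ↥L K).toSubring with hN'K
  haveI : IsDedekindDomain ↥N'K := hDed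
  have hLN' : L ≤ N'K := fun x hx =>
    show IsIntegral ↥L x from isIntegral_algebraMap (R := ↥L) (A := K) (x := ⟨x, hx⟩)
  have hN'O : N'K ≤ O.toSubring := h1r_integralClosure_le O fun r : ↥L => hLO r.2
  have hfracN' : ∀ z : K, ∃ a ∈ N'K, ∃ b ∈ N'K, b ≠ 0 ∧ z = a / b := fun z => by
    obtain ⟨a, ha, b, hb, hb0, rfl⟩ := hfracL z
    exact ⟨a, hLN' ha, b, hLN' hb, hb0, rfl⟩
  -- (4) `V = N'_{𝔪_O ∩ N'}` is a DVR and `O = V`, so `O` is a DVR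
  have hn' : subringCentre N'K O hN'O ≠ ⊥ := h1r_subringCentre_ne_bot N'K hfracN' O hN'O hO
  haveI := isLocalization_locAtCentre hN'O
  haveI : IsDiscreteValuationRing ↥(locAtCentre N'K O) :=
    IsLocalization.AtPrime.isDiscreteValuationRing_of_dedekind_domain ↥N'K hn' (locAtCentre N'K O)
  have hfracV : ∀ z : K, ∃ a ∈ locAtCentre N'K O, ∃ b ∈ locAtCentre N'K O, b ≠ 0 ∧ z = a / b :=
    fun z => by
    obtain ⟨a, ha, b, hb, hb0, rfl⟩ := hfracN' z
    exact ⟨a, le_locAtCentre N'K O ha, b, le_locAtCentre N'K O hb, hb0, rfl⟩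
  have hOV : O.toSubring = locAtCentre N'K O :=
    toSubring_eq_of_dvr_subring (locAtCentre N'K O) hfracV O (locAtCentre_le hN'O) hO
  have hdvr : IsDiscreteValuationRing ↥O :=
    IsDiscreteValuationRing.RingEquivClass.isDiscreteValuationRing
      (A := ↥(locAtCentre N'K O)) (B := ↥O)
      ({ toFun := fun x => ⟨x.1, locAtCentre_le hN'O x.2⟩, invFun := fun x => ⟨x.1, hOV.le x.2⟩,
         left_inv := fun _ => rfl, right_inv := fun _ => rfl, map_mul' := fun _ _ => rfl,
         map_add' := fun _ _ => rfl } : ↥(locAtCentre N'K O) ≃+* ↥O)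
  -- (5) the normalization `N` of `B`: finite over `B` (E. Noether), `B ⊆ N ⊆ O`
  haveI hfin : Module.Finite ↥B ↥(integralClosure ↥B K) :=
    NoetherFiniteIntegralClosure_holds k ↥B K K
  set NK : Subring K := (integralClosure ↥B K).toSubring with hNK
  have hBN : B.toSubring ≤ NK := fun x hx =>
    show IsIntegral ↥B x from isIntegral_algebraMap (R := ↥B) (A := K) (x := ⟨x, hx⟩)
  have hNO : NK ≤ O.toSubring := h1r_integralClosure_le O fun r : ↥B => hBO r.2
  -- (6) clearing denominators: `N' ⊆ N_{𝔪_O ∩ N}`, hence `O = V ⊆ N_{𝔪_O ∩ N}`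
  let φ : ↥B.toSubring →+* ↥B :=
    { toFun := fun b => ⟨b, b.2⟩
      map_one' := rfl
      map_mul' := fun _ _ => rfl
      map_zero' := rfl
      map_add' := fun _ _ => rfl }
  have hN'L : N'K ≤ locAtCentre NK O := by
    intro z hz
    have hz' : IsIntegral ↥L z := hz
    obtain ⟨m, hm⟩ := IsIntegral.exists_multiple_integral_of_isLocalization
      (subringCentre B.toSubring O hBO).primeCompl z hz'
    have hv : O.valuation ((m : ↥B.toSubring) : K) = 1 :=
      valuation_eq_one_of_not_mem_subringCentre hBO m.2
    have hint : IsIntegral ↥B (((m : ↥B.toSubring) : K) * z) := by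
      rw [Submonoid.smul_def, Algebra.smul_def] at hm
      exact hm.map_of_comp_eq φ (RingHom.id K) (RingHom.ext fun _ => rfl)
    refine ⟨((m : ↥B.toSubring) : K) * z, hint, ((m : ↥B.toSubring) : K),
      hBN (m : ↥B.toSubring).2, hv, ?_⟩
    rw [mul_div_cancel_left₀ _ (ne_zero_of_valuation_eq_one hv)]
  have hON : O.toSubring ≤ locAtCentre NK O := by
    rw [hOV]
    exact (locAtCentre_mono O hN'L).trans (locAtCentre_locAtCentre NK O).le
  -- (7) generators of `N` over `B`, and `N ⊆ (A 0)[S]`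
  obtain ⟨s, hs⟩ := Module.Finite.fg_top (R := ↥B) (M := ↥(integralClosure ↥B K))
  have hBA : B.toSubring ≤ A 0 := by
    rw [hA0]
    exact hBL
  have hSN : (↑(s.image fun c : ↥(integralClosure ↥B K) => (c : K)) : Set K) ⊆ NK := by
    intro x hx
    rw [Finset.coe_image] at hx
    obtain ⟨c, -, rfl⟩ := hx
    exact c.2
  have hNS : NK ≤ Subring.closure
      ((A 0 : Set K) ∪ ↑(s.image fun c : ↥(integralClosure ↥B K) => (c : K))) := by
    have key : ∀ x ∈ Submodule.span ↥B (s : Set ↥(integralClosure ↥B K)),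
        (x : K) ∈ Subring.closure
          ((A 0 : Set K) ∪ ↑(s.image fun c : ↥(integralClosure ↥B K) => (c : K))) := by
      intro x hx
      induction hx using Submodule.span_induction with
      | mem x hx =>
        refine Subring.subset_closure (Or.inr ?_)
        rw [Finset.coe_image]
        exact ⟨x, hx, rfl⟩
      | zero => exact Subring.zero_mem _
      | add x y _ _ hx hy => exact Subring.add_mem _ hx hy
      | smul a x _ hx =>
        change ((a : K) * (x : K)) ∈ _
        exact Subring.mul_mem _ (Subring.subset_closure (Or.inl (hBA a.2))) hx
    intro c hc
    have hcmem : (⟨c, hc⟩ : ↥(integralClosure ↥B K)) ∈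
        Submodule.span ↥B (s : Set ↥(integralClosure ↥B K)) := by
      rw [hs]; exact Submodule.mem_top
    exact key _ hcmem
  -- (8) `A 0 = L` is a one-dimensional Noetherian local domain dominated by `O`
  haveI : IsNoetherianRing ↥(A 0) := by
    rw [hA0]
    exact hLnoeth
  haveI : Ring.KrullDimLE 1 ↥(A 0) := by
    rw [hA0]
    exact hLdim
  have hof : IsLocalRingOf (A 0) := by
    rw [hA0]
    exact ⟨isLocalRing_locAtCentre hBO, hfracL⟩
  have h0 : SubringDominates (A 0) O.toSubring := by
    rw [hA0]
    exact subringDominates_locAtCentre hBO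
  exact ⟨hdvr, exists_sequence_eq_valuationSubring (A := A) hof h0 hstep hNO _ hSN hNS hON⟩

end Summit.ResolutionOfSingularities.ResolutionOfSingularities.Theorems

end
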